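import Mathlib
import HarnessLib
import Summits.NavierStokesRegularity.NavierStokesRegularity.Theorems.PoloidalWindowRigidity.Negative.TimeHeightShearFalseWithoutMild

/-!
# Item `LrcModEntire` (stmt-NavierStokesRegularity-20428), skeleton `slope-split` v1 — negative side:
# the (TH) germ stub `stub_timeHeightShearGerm` is FALSE without the Oseen-mild identity

Negative-side support (refuter seat ns-regularity-refuter1, cell ns-regularity-ideate; D-0081 §C), for the lead of item
20428 (skeleton `Cruxes/LrcModEntire/Lines/slope_split.lean`, v1: the promoted v3 stub `LrcModEntire` split by the
dependence of the shear slope — `stub_timeHeightShearGerm` on the (TH) stratum, in GERM currency, and the K2 lead's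
`stub_lrcGeneric` on the thick stratum, composition `LrcModEntire_of_slopeSplit` proved).

`stub_timeHeightShearGerm` has VERBATIM the hypotheses of the K2 lead's v4 stub `stub_timeHeightShear` — Type-I rate (R),
continuity on the open backward slab (C), the Oseen-mild identity (M), divergence-free slices (D), poloidality (P); a
non-empty open `W` in the slab with the three non-degeneracy pins; slope a function of time alone on no open subset of
`W`; slope a function of `(t, x₂)` on `W` — and concludes the germ trichotomy of `LrcModEntire` (translation germ or
vertical-rotation germ of the vorticity on a window of some slice, or a slice agreeing on a window with an entire field
of unbounded norm).

`timeHeightShearGerm_false_without_mild`: the text of the stub VERBATIM with hypothesis (M) deleted is FALSE.  The witness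
is the shifted cellular profile of `…LrcModEntire.Negative.ShiftField` / `…FalseWithoutMild` (`C = 10`, window
`{t < 0} × {cos x₀ > 0, 0 < x₂ < π/2}`): it satisfies (R), (C), (D), (P) (`…ShiftField`), the pins and the time-pin
(`…FalseWithoutMild.shiftProfile_pins/_slope_not_time_only`), it lies in the (TH) stratum with slope
`μ(x₂) = −sin x₂/(sin x₂ + 3)` (`…PoloidalWindowRigidity.Negative.shiftProfile_timeHeightSlope`), and NO slice has a
translation germ or a vertical-rotation germ of the vorticity on any window, nor agrees on a window with an unbounded
entire field (`…FalseWithoutMild.shiftProfile_no_translation_germ/_no_rotation_germ/_no_unbounded_entire_germ`).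
So — exactly as for the item itself (`lrcModEntire_false_without_mild`) and for v4's (TH) stub
(`timeHeightShear_false_without_mild`) — (M) is load-bearing for the germ stub: a non-symmetric, entire, BOUNDED (TH) germ
exists kinematically inside every other hypothesis; what the lead's `disprover-wanted` line asks for beyond this is such a
germ INSIDE the class, i.e. carried by a genuine poloidal Type-I ancient mild solution.

WHAT THIS IS NOT: not a claim about Navier–Stokes regularity and not a refutation of the stub or of item 20428 (both keep
(M)) — a kernel-checked certificate that hypothesis (M) of `stub_timeHeightShearGerm` cannot be dropped.
-/

noncomputable section

-- the summit and its single sub-problem share the name (CONVENTIONS §1), as in every Theorems file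
set_option linter.dupNamespace false

namespace Summit.NavierStokesRegularity.NavierStokesRegularity.Theorems.LrcModEntire.Negative

open Set Function
open scoped RealInnerProductSpace InnerProductSpace
open Literature.Analysis Literature.Analysis.FluidPDE
open Summit.NavierStokesRegularity.NavierStokesRegularity.Theorems.PoloidalWindowRigidity.Negative

/-- **`stub_timeHeightShearGerm` (skeleton `slope-split` v1 of item 20428) without the Oseen-mild identity is FALSE.**
The negated statement is the stub's text verbatim with the hypothesis
`(∀ s t, s < t → t < 0 → ∀ x, v t x = heatExtension (v s) (t - s) x - oseenDuhamel 1 s v v t x)` deleted; the witness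
is the shifted cellular profile `shiftProfile` with `C = 10` and the window `shiftWindow`, which lies in the (TH) stratum
(`shiftProfile_timeHeightSlope`, slope `−sin x₂/(sin x₂+3)`) and defeats all three alternatives of the conclusion.
[folklore] -/
theorem timeHeightShearGerm_false_without_mild :
    ¬ (∀ (C : ℝ) (v : ℝ → EuclideanSpace ℝ (Fin 3) → EuclideanSpace ℝ (Fin 3)),
        Literature.Analysis.FluidPDE.HasTypeITimeDecay C v →
        ContinuousOn (Function.uncurry v) (Set.Iio (0 : ℝ) ×ˢ Set.univ) →
        (∀ t < 0, Literature.Analysis.FluidPDE.VectorCalculus.IsDivFree (v t)) →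
        (∀ s < 0, ∀ y, ⟪Literature.Analysis.FluidPDE.curl (v s) y, EuclideanSpace.single 2 1⟫_ℝ = 0) →
        ∀ W : Set (ℝ × EuclideanSpace ℝ (Fin 3)), IsOpen W → W.Nonempty → W ⊆ Set.Iio (0 : ℝ) ×ˢ Set.univ →
          (∀ z ∈ W, Literature.Analysis.FluidPDE.curl (v z.1) z.2 ≠ 0 ∧
            (fderiv ℝ (v z.1) z.2 (EuclideanSpace.single 0 1) 2 ≠ 0 ∨ fderiv ℝ (v z.1) z.2 (EuclideanSpace.single 1 1) 2 ≠ 0) ∧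
            (fderiv ℝ (v z.1) z.2 (EuclideanSpace.single 2 1) 0 ≠ 0 ∨ fderiv ℝ (v z.1) z.2 (EuclideanSpace.single 2 1) 1 ≠ 0)) →
          (∀ m : ℝ → ℝ, ∀ W₁ : Set (ℝ × EuclideanSpace ℝ (Fin 3)), W₁ ⊆ W → IsOpen W₁ → W₁.Nonempty →
            ∃ z ∈ W₁, ∃ b : Fin 3, b ≠ 2 ∧
              fderiv ℝ (v z.1) z.2 (EuclideanSpace.single 2 1) b ≠
                m z.1 * fderiv ℝ (v z.1) z.2 (EuclideanSpace.single b 1) 2) →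
          (∃ m : ℝ → ℝ → ℝ, ∀ z ∈ W, ∀ b : Fin 3, b ≠ 2 →
            fderiv ℝ (v z.1) z.2 (EuclideanSpace.single 2 1) b =
              m z.1 (z.2 2) * fderiv ℝ (v z.1) z.2 (EuclideanSpace.single b 1) 2) →
          ∃ s : ℝ, s < 0 ∧ ∃ U : Set (EuclideanSpace ℝ (Fin 3)), IsOpen U ∧ U.Nonempty ∧
            ((∃ e : EuclideanSpace ℝ (Fin 3), e ≠ 0 ∧ ∀ y ∈ U, fderiv ℝ (Literature.Analysis.FluidPDE.curl (v s)) y e = 0) ∨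
             (∃ c : EuclideanSpace ℝ (Fin 3), ∀ y ∈ U,
                Literature.Analysis.FluidPDE.rotGen (Literature.Analysis.FluidPDE.curl (v s) y) =
                  fderiv ℝ (Literature.Analysis.FluidPDE.curl (v s)) y (Literature.Analysis.FluidPDE.rotGen (y - c))) ∨
             (∃ w : EuclideanSpace ℝ (Fin 3) → EuclideanSpace ℝ (Fin 3), AnalyticOnNhd ℝ w Set.univ ∧
                ¬ BddAbove (Set.range fun y => ‖w y‖) ∧ ∀ y ∈ U, v s y = w y))) := by
  intro H
  obtain ⟨s, hs, U, hU, hne, halt⟩ := H 10 shiftProfile hasTypeITimeDecay_shiftProfile continuousOn_shiftProfile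
    (fun t _ => isDivFree_shiftProfile t) (fun s _ y => poloidal_shiftProfile s y) shiftWindow isOpen_shiftWindow
    shiftWindow_nonempty shiftWindow_subset shiftProfile_pins
    (fun m W₁ hW₁ hW₁o hW₁n => shiftProfile_slope_not_time_only m W₁ hW₁ hW₁o hW₁n)
    ⟨fun _ h => -Real.sin h / (Real.sin h + 3), fun z _ b hb => shiftProfile_timeHeightSlope z b hb⟩
  rcases halt with ⟨e, he, htr⟩ | ⟨c, hrot⟩ | ⟨w, hw, hunb, hwU⟩
  · exact shiftProfile_no_translation_germ hs hU hne he htr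
  · exact shiftProfile_no_rotation_germ hs hU hne c hrot
  · exact hunb (shiftProfile_no_unbounded_entire_germ s hU hne hw hwU)

end Summit.NavierStokesRegularity.NavierStokesRegularity.Theorems.LrcModEntire.Negative

end
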